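import Summits.Ventures.PercRepro.ProfileFlatUpsetContract

/-!
# PercRepro — THE EXACT DROP OF (G) UNDER CONTRACTION: `S_M(U) − S_{M ／ e}(U ∖ e)` IN CLOSED FORM
(p10, gen 18; `proofs/P10-AVFULL.md` §26(f))

For a finite matroid `M`, an up-set `U` of its flats and a non-loop `e`, the separated sets `sepSets M U` split into
four classes by the position of `e`: `sepA` (`e ∉ Z`, `e ∉ cl Z`), `sepB` (`e ∉ Z`, `e ∈ cl Z`), `sepC` (`e ∈ Z`,
`e ∉ cl (E ∖ Z)`), `sepD` (`e ∈ Z`, `e ∈ cl (E ∖ Z)`).  Inside `sepC`, the sets with `cl ((E ∖ Z) ∪ e) ∉ U` (`sepC0`)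
are exactly the separated sets of the contraction `M ／ e` with the induced up-set, shifted by `e`
(`sum_sepC0_eq_sum_contract`: `Z ↦ Z ∖ e`, the weight `2 #Z − N − 1` dropping by `1`).  Hence THE DROP IDENTITY
(`drop_identity_upset`):

  `S_M(U) − S_{M ／ e}(U ∖ e) = Σ_{sepA} w + Σ_{sepB} w + Σ_{sepD} w + Σ_{sepC ∖ sepC0} w + #sepC0`,  `w = 2 #Z − N − 1`,

and the conjecture (G-CM) (`FlatUpsetContractMono`, NOT asserted) at `(M, U, e)` is exactly the non-negativity of this
right-hand side (`contract_drop_nonneg_iff`).  The move `Z ↦ Z ∪ e` injects `sepA` into `sepC0` (`card_sepA_le`), so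
the drop is also `Σ_{sepA} (w + 1) + Σ_{sepB ∪ sepD ∪ (sepC ∖ sepC0)} w + #(sepC0 ∖ image)`.  In the pointed case this
is the gen-15 drop identity of the coloop limit with the classes `U₁, U₂, V₁, V₂` replaced by their up-set versions.
Census (kit j278761, j279558): the right-hand side is `≥ 0` on 371,028,672 `(M, U, e)` at `n = 9`, while neither
`Σ_{sepA} (w + 1)` nor `Σ_{sepB ∪ sepD} w` is `≥ 0` on its own (887 resp. 1 failures).  Nothing here asserts (G-CM).
-/

open scoped Matroid

namespace PercRepro.Cogirth

open Finset ThmH Skew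

variable {α : Type} [DecidableEq α] {M : Matroid α} [M.Finite]

/-! ### The four classes -/

/-- `e` outside, not spanned: the up-movable separated sets. -/
noncomputable def sepA (M : Matroid α) [M.Finite] (U : Finset (Finset α)) (e : α) : Finset (Finset α) :=
  (sepSets M U).filter (fun Z => e ∉ Z ∧ e ∉ clF M Z)

/-- `e` outside, spanned by `Z`. -/
noncomputable def sepB (M : Matroid α) [M.Finite] (U : Finset (Finset α)) (e : α) : Finset (Finset α) :=
  (sepSets M U).filter (fun Z => e ∉ Z ∧ e ∈ clF M Z)

/-- `e` inside, not spanned by the complement: the down-movable separated sets. -/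
noncomputable def sepC (M : Matroid α) [M.Finite] (U : Finset (Finset α)) (e : α) : Finset (Finset α) :=
  (sepSets M U).filter (fun Z => e ∈ Z ∧ e ∉ clF M (gr M \ Z))

/-- `e` inside, spanned by the complement. -/
noncomputable def sepD (M : Matroid α) [M.Finite] (U : Finset (Finset α)) (e : α) : Finset (Finset α) :=
  (sepSets M U).filter (fun Z => e ∈ Z ∧ e ∈ clF M (gr M \ Z))

/-- The contraction part of `sepC`: `cl ((E ∖ Z) ∪ e) ∉ U`. -/
noncomputable def sepC0 (M : Matroid α) [M.Finite] (U : Finset (Finset α)) (e : α) : Finset (Finset α) :=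
  (sepC M U e).filter (fun Z => clF M (insert e (gr M \ Z)) ∉ U)

/-- The rest of `sepC`: `cl ((E ∖ Z) ∪ e) ∈ U`. -/
noncomputable def sepCrest (M : Matroid α) [M.Finite] (U : Finset (Finset α)) (e : α) : Finset (Finset α) :=
  (sepC M U e).filter (fun Z => clF M (insert e (gr M \ Z)) ∈ U)

/-- The signed sum over the separated sets is the sum over the four classes. -/
theorem sum_sepSets_eq_classes (U : Finset (Finset α)) (e : α) :
    ∑ Z ∈ sepSets M U, (2 * (Z.card : ℤ) - (gr M).card - 1) =
      ∑ Z ∈ sepA M U e, (2 * (Z.card : ℤ) - (gr M).card - 1) +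
        ∑ Z ∈ sepB M U e, (2 * (Z.card : ℤ) - (gr M).card - 1) +
        ∑ Z ∈ sepC M U e, (2 * (Z.card : ℤ) - (gr M).card - 1) +
        ∑ Z ∈ sepD M U e, (2 * (Z.card : ℤ) - (gr M).card - 1) := by
  unfold sepA sepB sepC sepD
  rw [← sum_filter_add_sum_filter_not (sepSets M U) (fun Z => e ∉ Z)]
  have h1 : (sepSets M U).filter (fun Z => ¬ e ∉ Z) = (sepSets M U).filter (fun Z => e ∈ Z) := by
    apply filter_congr
    intro Z _
    exact not_not
  rw [h1, ← sum_filter_add_sum_filter_not ((sepSets M U).filter (fun Z => e ∉ Z)) (fun Z => e ∉ clF M Z),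
    ← sum_filter_add_sum_filter_not ((sepSets M U).filter (fun Z => e ∈ Z)) (fun Z => e ∉ clF M (gr M \ Z)),
    filter_filter, filter_filter, filter_filter, filter_filter]
  have h2 : (sepSets M U).filter (fun Z => e ∉ Z ∧ ¬ e ∉ clF M Z) =
      (sepSets M U).filter (fun Z => e ∉ Z ∧ e ∈ clF M Z) := by
    apply filter_congr
    intro Z _
    rw [not_not]
  have h3 : (sepSets M U).filter (fun Z => e ∈ Z ∧ ¬ e ∉ clF M (gr M \ Z)) =
      (sepSets M U).filter (fun Z => e ∈ Z ∧ e ∈ clF M (gr M \ Z)) := by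
    apply filter_congr
    intro Z _
    rw [not_not]
  rw [h2, h3]
  ring

/-- `sepC` splits into its contraction part and the rest. -/
theorem sum_sepC_eq (U : Finset (Finset α)) (e : α) :
    ∑ Z ∈ sepC M U e, (2 * (Z.card : ℤ) - (gr M).card - 1) =
      ∑ Z ∈ sepC0 M U e, (2 * (Z.card : ℤ) - (gr M).card - 1) +
        ∑ Z ∈ sepCrest M U e, (2 * (Z.card : ℤ) - (gr M).card - 1) := by
  unfold sepC0 sepCrest
  rw [← sum_filter_add_sum_filter_not (sepC M U e) (fun Z => clF M (insert e (gr M \ Z)) ∉ U)]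
  congr 1
  apply sum_congr _ (fun _ _ => rfl)
  apply filter_congr
  intro Z _
  exact not_not

/-! ### The contraction bijection -/

/-- A flat `F ∋ e` of `M` with `F ∖ e` in the induced up-set lies in `U`. -/
theorem mem_of_erase_mem_upsetContract {U : Finset (Finset α)} {e : α} {F : Finset α} (he : e ∈ F)
    (h : F.erase e ∈ upsetContract U e) : F ∈ U := by
  obtain ⟨F', hF', heF', hFF'⟩ := mem_upsetContract.1 h
  have : F' = F := by
    rw [← insert_erase heF', hFF', insert_erase he]
  rw [← this]
  exact hF'

/-- `(cl_M X) ∖ e` lies in the induced up-set iff `cl_M X ∈ U`, when `e ∈ cl_M X`. -/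
theorem erase_clF_mem_upsetContract_iff {U : Finset (Finset α)} {e : α} {X : Finset α}
    (he : e ∈ clF M X) : (clF M X).erase e ∈ upsetContract U e ↔ clF M X ∈ U := by
  constructor
  · exact mem_of_erase_mem_upsetContract he
  · intro h
    rw [mem_upsetContract]
    exact ⟨clF M X, h, he, rfl⟩

/-- **THE CONTRACTION BIJECTION**: the signed sum over `sepC0` is the signed sum over the separated sets of
`M ／ e` plus their number. -/
theorem sum_sepC0_eq_sum_contract {U : Finset (Finset α)} (hU : UpFlats M U) {e : α} (heI : M.Indep ({e} : Set α)) :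
    ∑ Z ∈ sepC0 M U e, (2 * (Z.card : ℤ) - (gr M).card - 1) =
      ∑ W ∈ sepSets (M ／ ({e} : Set α)) (upsetContract U e),
        ((2 * (W.card : ℤ) - (gr (M ／ ({e} : Set α))).card - 1) + 1) := by
  have he : e ∈ gr M := mem_gr_of_indep heI
  have hgr : (gr (M ／ ({e} : Set α))).card + 1 = (gr M).card := by
    rw [gr_contract', card_erase_add_one he]
  unfold sepC0 sepC
  apply sum_nbij' (fun Z => Z.erase e) (fun W => insert e W)
  · intro Z hZ
    rw [mem_filter, mem_filter, mem_sepSets, mem_biIndepAll] at hZ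
    obtain ⟨⟨⟨⟨hZg, hZr, hZc⟩, hin, hout⟩, heZ, hecl⟩, hC0⟩ := hZ
    have hZeg : Z.erase e ⊆ (gr M).erase e := erase_subset_erase e hZg
    have hcg : gr M \ Z ⊆ (gr M).erase e := by
      intro z hz
      rw [mem_sdiff] at hz
      exact mem_erase.2 ⟨fun h => hz.2 (h ▸ heZ), hz.1⟩
    have h1 := rk_contract_add_one heI hZeg
    rw [insert_erase heZ, hZr] at h1
    have h2 := rk_contract_add_one heI hcg
    have heZc : e ∉ gr M \ Z := fun h => (mem_sdiff.1 h).2 heZ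
    rw [rk_insert_eq_card_of_notMem_clF he sdiff_subset hZc heZc hecl, card_insert_of_notMem heZc] at h2
    rw [mem_sepSets, mem_biIndepAll, gr_contract', gr_erase_sdiff_erase_of_mem_series heZ]
    refine ⟨⟨hZeg, ?_, ?_⟩, ?_, ?_⟩
    · rw [card_erase_of_mem heZ]
      omega
    · omega
    · rw [clF_contract, insert_erase heZ]
      exact (erase_clF_mem_upsetContract_iff (subset_clF_fu hZg heZ)).2 hin
    · rw [clF_contract]
      intro hcon
      apply hC0
      exact mem_of_erase_mem_upsetContract (subset_clF_fu (insert_subset he sdiff_subset) (mem_insert_self e _)) hcon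
  · intro W hW
    rw [mem_sepSets, mem_biIndepAll, gr_contract'] at hW
    obtain ⟨⟨hWg, hWr, hWc⟩, hin, hout⟩ := hW
    have heW : e ∉ W := fun h => (mem_erase.1 (hWg h)).1 rfl
    have hWg0 : W ⊆ gr M := fun x hx => (mem_erase.1 (hWg hx)).2
    have hcomp : gr M \ insert e W = (gr M).erase e \ W := by
      rw [sdiff_insert, erase_sdiff]
    have hcg : (gr M).erase e \ W ⊆ (gr M).erase e := sdiff_subset
    have hec : e ∉ (gr M).erase e \ W := fun h => (mem_erase.1 (mem_sdiff.1 h).1).1 rfl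
    have h1 := rk_contract_add_one heI hWg
    rw [hWr] at h1
    have h2 := rk_contract_add_one heI hcg
    rw [hWc] at h2
    have h4 := rk_insert_le (M := M) e ((gr M).erase e \ W)
    have h5 := rk_le_card (M := M) ((gr M).erase e \ W)
    have hcr : rk M ((gr M).erase e \ W) = ((gr M).erase e \ W).card := by omega
    rw [clF_contract] at hin hout
    rw [mem_filter, mem_filter, mem_sepSets, mem_biIndepAll, hcomp]
    refine ⟨⟨⟨⟨insert_subset he hWg0, ?_, hcr⟩, ?_, ?_⟩, mem_insert_self e W, ?_⟩, ?_⟩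
    · rw [card_insert_of_notMem heW]
      omega
    · exact mem_of_erase_mem_upsetContract (subset_clF_fu (insert_subset he hWg0) (mem_insert_self e W)) hin
    · intro hcon
      apply hout
      rw [erase_clF_mem_upsetContract_iff (subset_clF_fu (insert_subset he (hcg.trans (erase_subset e _))) (mem_insert_self e _))]
      exact hU.up _ hcon _ (isFlatF_clF _) (clF_mono_fu (subset_insert e _))
    · rw [mem_clF_iff_rk_insert_eq he (sdiff_subset.trans (erase_subset _ _))]
      omega
    · intro hcon
      apply hout
      rw [erase_clF_mem_upsetContract_iff (subset_clF_fu (insert_subset he (hcg.trans (erase_subset e _))) (mem_insert_self e _))]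
      exact hcon
  · intro Z hZ
    rw [mem_filter, mem_filter] at hZ
    exact insert_erase hZ.1.2.1
  · intro W hW
    rw [mem_sepSets, mem_biIndepAll, gr_contract'] at hW
    exact erase_insert (fun h => (mem_erase.1 (hW.1.1 h)).1 rfl)
  · intro Z hZ
    rw [mem_filter, mem_filter] at hZ
    have heZ : e ∈ Z := hZ.1.2.1
    rw [card_erase_of_mem heZ]
    have h0 : 0 < Z.card := card_pos.2 ⟨e, heZ⟩
    have h1 : ((Z.card - 1 : ℕ) : ℤ) = (Z.card : ℤ) - 1 := by
      rw [Nat.cast_sub h0]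
      simp
    have h2 : ((gr (M ／ ({e} : Set α))).card : ℤ) = (gr M).card - 1 := by
      have := hgr
      omega
    rw [h1, h2]
    ring

/-! ### The drop identity -/

/-- **THE DROP IDENTITY**: `S_M(U) = S_{M ／ e}(U ∖ e) + #sepSets(M ／ e) + Σ_{sepA} w + Σ_{sepB} w + Σ_{sepD} w + Σ_{sepCrest} w`. -/
theorem drop_identity_upset {U : Finset (Finset α)} (hU : UpFlats M U) {e : α} (heI : M.Indep ({e} : Set α)) :
    ∑ Z ∈ sepSets M U, (2 * (Z.card : ℤ) - (gr M).card - 1) =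
      ∑ W ∈ sepSets (M ／ ({e} : Set α)) (upsetContract U e), (2 * (W.card : ℤ) - (gr (M ／ ({e} : Set α))).card - 1) +
        ((sepSets (M ／ ({e} : Set α)) (upsetContract U e)).card +
          ∑ Z ∈ sepA M U e, (2 * (Z.card : ℤ) - (gr M).card - 1) +
          ∑ Z ∈ sepB M U e, (2 * (Z.card : ℤ) - (gr M).card - 1) +
          ∑ Z ∈ sepD M U e, (2 * (Z.card : ℤ) - (gr M).card - 1) +
          ∑ Z ∈ sepCrest M U e, (2 * (Z.card : ℤ) - (gr M).card - 1)) := by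
  rw [sum_sepSets_eq_classes U e, sum_sepC_eq U e, sum_sepC0_eq_sum_contract hU heI, sum_add_distrib, sum_const,
    nsmul_eq_mul, mul_one]
  ring

/-- **(G-CM) AT `(M, U, e)` IN CLOSED FORM**: the drop is non-negative iff
`#sepSets(M ／ e) + Σ_{sepA} w + Σ_{sepB} w + Σ_{sepD} w + Σ_{sepCrest} w ≥ 0`. -/
theorem contract_drop_nonneg_iff {U : Finset (Finset α)} (hU : UpFlats M U) {e : α} (heI : M.Indep ({e} : Set α)) :
    (∑ W ∈ sepSets (M ／ ({e} : Set α)) (upsetContract U e), (2 * (W.card : ℤ) - (gr (M ／ ({e} : Set α))).card - 1) ≤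
        ∑ Z ∈ sepSets M U, (2 * (Z.card : ℤ) - (gr M).card - 1)) ↔
      0 ≤ ((sepSets (M ／ ({e} : Set α)) (upsetContract U e)).card : ℤ) +
          ∑ Z ∈ sepA M U e, (2 * (Z.card : ℤ) - (gr M).card - 1) +
          ∑ Z ∈ sepB M U e, (2 * (Z.card : ℤ) - (gr M).card - 1) +
          ∑ Z ∈ sepD M U e, (2 * (Z.card : ℤ) - (gr M).card - 1) +
          ∑ Z ∈ sepCrest M U e, (2 * (Z.card : ℤ) - (gr M).card - 1) := by
  rw [drop_identity_upset hU heI]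
  constructor
  · intro h; linarith
  · intro h; linarith

/-! ### The up-move injection `sepA → sepC0` -/

/-- The move `Z ↦ Z ∪ e` sends `sepA` into `sepC0`. -/
theorem insert_mem_sepC0_of_mem_sepA {U : Finset (Finset α)} (hU : UpFlats M U) {e : α} (he : e ∈ gr M)
    {Z : Finset α} (hZ : Z ∈ sepA M U e) : insert e Z ∈ sepC0 M U e := by
  unfold sepA at hZ
  rw [mem_filter] at hZ
  obtain ⟨hZs, heZ, hecl⟩ := hZ
  have hZb : Z ∈ biIndepAll M := (mem_sepSets.1 hZs).1
  have hins : insert e Z ∈ biIndepAll M := (insert_mem_biIndepAll_iff hZb he heZ).2 hecl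
  have hZs' : insert e Z ∈ sepSets M U := mem_sepSets_of_subset hU hZs hins (subset_insert e Z)
  have hcomp : gr M \ insert e Z = (gr M \ Z).erase e := by
    ext y
    simp only [mem_sdiff, mem_insert, mem_erase, not_or]
    tauto
  have hcind : M.Indep ((gr M \ Z : Finset α) : Set α) := indep_sdiff_of_mem_biIndepAll hZb
  have heZc : e ∈ gr M \ Z := mem_sdiff.2 ⟨he, heZ⟩
  unfold sepC0 sepC
  rw [mem_filter, mem_filter]
  refine ⟨⟨hZs', mem_insert_self e Z, ?_⟩, ?_⟩
  · rw [hcomp]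
    exact notMem_clF_erase_of_indep hcind heZc
  · rw [hcomp, insert_erase heZc]
    exact (mem_sepSets.1 hZs).2.2

/-- The move `Z ↦ Z ∪ e` is injective on `sepA`. -/
theorem card_sepA_le {U : Finset (Finset α)} (hU : UpFlats M U) {e : α} (he : e ∈ gr M) :
    (sepA M U e).card ≤ (sepC0 M U e).card := by
  apply card_le_card_of_injOn (fun Z => insert e Z) (fun Z hZ => insert_mem_sepC0_of_mem_sepA hU he hZ)
  intro Z₁ hZ₁ Z₂ hZ₂ heq
  have h1 : e ∉ Z₁ := ((mem_filter.1 hZ₁).2).1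
  have h2 : e ∉ Z₂ := ((mem_filter.1 hZ₂).2).1
  have heq' : insert e Z₁ = insert e Z₂ := heq
  rw [← erase_insert h1, ← erase_insert h2, heq']

end PercRepro.Cogirth
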